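import Literature.AnabelianGeometry.EtaleTheta.GalSectSplittingsCohomology
import Literature.AnabelianGeometry.EtaleTheta.GKCyclotomeJunction
import Literature.AnabelianGeometry.EtaleTheta.SettingModelCyclotomicCharacter
import Literature.NumberTheory.GaloisRepresentations.TateModuleKummerCompletion
import HarnessLib

/-!
# [GalSect] §4: «`D_x/I_x = G_K`» and «`Ẑ(1)`» = the Tate module — the two dictionaries behind
# `H¹(G_K, Ẑ(1)) ≅ (K^×)^∧` for the cusp torsor (bricks for `GalSectCuspTorsorStructureGroupKummer`)

S. Mochizuki, *Galois sections in absolute anabelian geometry* [GalSect], Nagoya Math. J. **179** (2005), §4 p. 33: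
«we have an exact sequence `1 → I_x → D_x → G_K → 1`, `I_x ≅ Ẑ(1)` … the splittings … form a torsor over
`H¹(G_K, Ẑ(1)) ≅ (K^×)^∧`» [cite: MochizukiGalSect2005, §4 p.33].  Classical inputs: profinite `Ẑ = lim ℤ/n`
[cite: RibesZalesskii2010, Thm 2.7.1]; the cyclotomic character [cite: NeukirchANT1999, Ch. IV §1].

abc-iut cell, layer L2, seat abc-iut-w5-d029 (gen 7), row «(GEN)-FROM-PRINT-CLAUSES» (sequel (S1) of the C7e lineage
p452745 / p454786 / p456299 / p461520): the K2 / [EtTh] Thm 1.10 (iii) END-KNIT binder (gen) asks for SOME identification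
`κ : (K^×)^∧ ≃* Ker(res : H¹(D, I) → H¹(I, I))`; print supplies it as inflation `Ker(res) = H¹(D/I, I)` + «`D/I = G_K`» +
«`I = Ẑ(1)`» + Kummer theory.  This PROOF-ONLY file (no definition, no `Prop` fact, no instance) proves the two dictionaries:

* `GalSect.CuspPair.exists_quotient_continuousMulEquiv_of_isCompact` — **`D/I ≃ₜ* G_K`**: for a cuspidal pair `(D, I)` with
  `D` compact, `I = D ∩ Ker α`, `α(D) = L` (`α : Γ → G′` continuous into a Hausdorff group) the quotient `↥⊤/I ≤ ↥D`
  (the shape consumed by abc-iut-L2-t12's `ContH1.kerResEquivQuotient` / `CuspPair.resKerEquivH1Quotient`) is isomorphic to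
  `L` as a TOPOLOGICAL group by `[d] ↦ α d` (continuous bijection compact → Hausdorff);
* `cyclotome.pow_div_apply`, `ZHatLevel.isLocallyConstant_level` — bookkeeping (`ζ_m^{m/n} = ζ_n`; `Ẑ → ℤ/n` locally constant);
* `GalSect.exists_chi_tateModule_dictionary` — **«`Ẑ` with the cyclotomic character» IS the Tate module**: given
  `L ≤ G_{ℚ_p}`, `Φ : L → Gal(K^al/K)` and a ring isomorphism `ι : K^al ≅ ℚ̄_p` with `ι(Φ(σ)x) = σ(ιx)` (the junction of
  abc-iut-w6-d047's `exists_GK_continuousMulEquiv_absoluteGaloisGroup`), a continuous additive BIJECTION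
  `m : Ẑ → T_μ(K^al) = lim_n μ_n(K^al)` (`tateModuleMu`, abc-iut-L4) with `m(χ(σ)·z) = Φ(σ)·m(z)` for abc-iut-w5-d091's canonical
  cyclotomic character `SettingModel.chi` — built from a generator of `Λ(ℚ̄_pˣ)` (`cyclotome.exists_generator_mulEquiv_zHat_of_isSepClosed`)
  as `z ↦ (ι⁻¹(ξ_n^{z mod n}))_n`, equivariance = `σ(ζ) = ζ^{χ_n(σ)}` (`SettingModel.apply_eq_pow_levelChar_chi`).

HONEST FRAMING: classical Galois/profinite bookkeeping over the tree's own constructions; [GalSect] is refereed; nothing of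
[EtTh] is asserted; no side taken on [IUTchIII] Cor. 3.12; typed ≠ proved.
-/

noncomputable section

namespace Literature.AnabelianGeometry.EtaleTheta

open Literature.AnabelianGeometry.SemiGraphs
open Literature.NumberTheory.GaloisRepresentations
open Literature.NumberTheory.GaloisRepresentations.DiscreteGaloisModule
open CategoryTheory ProfiniteGrp ProfiniteGrp.ProfiniteCompletion
open _root_.Topology _root_.Function

/-! ### §1. `D/I ≃ₜ* G_K` for a compact cuspidal pair -/

namespace GalSect.CuspPair

variable {Γ : Type*} [Group Γ] [TopologicalSpace Γ] {G' : Type*} [Group G'] [TopologicalSpace G'] [T2Space G']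

/-- **`D/I ≃ₜ* G_K`** ([GalSect] §4 p. 33: «`1 → I_x → D_x → G_K → 1`»).  For a cuspidal pair `(D, I)` with `D` COMPACT,
`I = D ∩ Ker α` and `α(D) = L`, where `α : Γ → G′` is a continuous homomorphism into a Hausdorff group: the quotient `D/I`
— in the shape `↥⊤ ⧸ I.subgroupOf ⊤` inside `↥D` of `ContH1.kerResEquivQuotient` — is isomorphic to `L` as a topological
group, by `[d] ↦ α d` (a continuous bijection from a compact space onto a Hausdorff space is a homeomorphism).
[cite: MochizukiGalSect2005, §4 p.33] -/
theorem exists_quotient_continuousMulEquiv_of_isCompact (P : CuspPair Γ) (α : Γ →ₜ* G') (L : Subgroup G')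
    (hDc : IsCompact (P.D : Set Γ)) (hI : ∀ d ∈ P.D, d ∈ P.I ↔ α d = 1) (hrat : P.D.map α.toMonoidHom = L) :
    haveI := P.ID_normal
    ∃ θ : (↥(⊤ : Subgroup P.D) ⧸ (P.ID.subgroupOf ⊤)) ≃ₜ* L,
      ∀ d : ↥(⊤ : Subgroup P.D), ((θ (QuotientGroup.mk d) : L) : G') = α ((d : P.D) : Γ) := by
  haveI := P.ID_normal
  -- `α` restricted to `↥⊤ ≤ ↥D`, with values in `L`
  have hmem : ∀ d : ↥(⊤ : Subgroup P.D), α ((d : P.D) : Γ) ∈ L := fun d => by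
    rw [← hrat]; exact ⟨(d : P.D), (d : P.D).2, rfl⟩
  let f : ↥(⊤ : Subgroup P.D) →* L :=
    { toFun := fun d => ⟨α ((d : P.D) : Γ), hmem d⟩
      map_one' := Subtype.ext (by simp)
      map_mul' := fun a b => Subtype.ext (by simp) }
  have hf : ∀ d : ↥(⊤ : Subgroup P.D), ((f d : L) : G') = α ((d : P.D) : Γ) := fun _ => rfl
  have hfc : Continuous f :=
    Continuous.subtype_mk ((α.continuous.comp continuous_subtype_val).comp continuous_subtype_val) _
  have hker : P.ID.subgroupOf ⊤ = f.ker := by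
    ext d
    rw [Subgroup.mem_subgroupOf, Subgroup.mem_subgroupOf, MonoidHom.mem_ker, ← Subtype.coe_inj, hf,
      OneMemClass.coe_one]
    exact hI _ (d : P.D).2
  have hsurj : Surjective f := by
    intro y
    have hy : (y : G') ∈ P.D.map α.toMonoidHom := by rw [hrat]; exact y.2
    obtain ⟨d, hd, hdy⟩ := hy
    exact ⟨⟨⟨d, hd⟩, Subgroup.mem_top _⟩, Subtype.ext hdy⟩
  let θ₀ : (↥(⊤ : Subgroup P.D) ⧸ (P.ID.subgroupOf ⊤)) ≃* L :=
    (QuotientGroup.quotientMulEquivOfEq hker).trans (QuotientGroup.quotientKerEquivOfSurjective f hsurj)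
  have hθ₀ : ∀ d : ↥(⊤ : Subgroup P.D), θ₀ (QuotientGroup.mk d) = f d := fun d => by
    change QuotientGroup.quotientKerEquivOfSurjective f hsurj
      (QuotientGroup.quotientMulEquivOfEq hker (QuotientGroup.mk d)) = f d
    rw [QuotientGroup.quotientMulEquivOfEq_mk]
    exact QuotientGroup.kerLift_mk f d
  -- continuity of `θ₀`: it lifts the continuous `f` through the quotient map
  have hθ₀c : Continuous θ₀ := by
    have hcomp : Continuous (θ₀ ∘ QuotientGroup.mk) := by
      have : (θ₀ ∘ QuotientGroup.mk : ↥(⊤ : Subgroup P.D) → L) = f := funext fun d => hθ₀ d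
      rw [this]; exact hfc
    exact (QuotientGroup.isQuotientMap_mk (P.ID.subgroupOf ⊤)).continuous_iff.mpr hcomp
  -- compact source, Hausdorff target
  haveI : CompactSpace P.D := isCompact_iff_compactSpace.mp hDc
  haveI : CompactSpace ↥(⊤ : Subgroup P.D) :=
    isCompact_iff_compactSpace.mp (Subgroup.coe_top (G := P.D) ▸ isCompact_univ)
  haveI : CompactSpace (↥(⊤ : Subgroup P.D) ⧸ (P.ID.subgroupOf ⊤)) := Quotient.compactSpace
  let θh : (↥(⊤ : Subgroup P.D) ⧸ (P.ID.subgroupOf ⊤)) ≃ₜ L :=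
    Continuous.homeoOfEquivCompactToT2 (f := θ₀.toEquiv) hθ₀c
  refine ⟨{ θ₀ with continuous_toFun := θh.continuous, continuous_invFun := θh.symm.continuous }, fun d => ?_⟩
  change ((θ₀ (QuotientGroup.mk d) : L) : G') = _
  rw [hθ₀ d]
  rfl

end GalSect.CuspPair

/-! ### §2. Bookkeeping: `ζ_m^{m/n} = ζ_n` in a cyclotome; `Ẑ → ℤ/n` is locally constant -/

/-- In a cyclotome `Λ(A) = lim_n A[n]`: `ζ_m ^ (m / n) = ζ_n` for `n ∣ m`. [cite: LANA2026Report, §6.1 p.31] -/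
theorem cyclotome.pow_div_apply {A : Type*} [CommGroup A] (ζ : cyclotome A) {n m : ℕ+} (h : (n : ℕ) ∣ m) :
    (ζ : ℕ+ → A) m ^ ((m : ℕ) / n) = (ζ : ℕ+ → A) n := by
  obtain ⟨d, hd⟩ := h
  have hdpos : 0 < d := Nat.pos_of_ne_zero fun h0 => by simp [h0] at hd
  have hm : m = n * ⟨d, hdpos⟩ := PNat.eq hd
  subst hm
  rw [PNat.mul_coe, PNat.mk_coe, Nat.mul_div_cancel_left d n.pos]
  exact cyclotome.pow_apply_mul ζ n ⟨d, hdpos⟩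

/-- The level characters `Ẑ → ℤ/nℤ` are locally constant (their kernels are open, `ZHatLevel.isOpen_ker_level`).
[cite: RibesZalesskii2010, Thm 2.7.1] -/
theorem ZHatLevel.isLocallyConstant_level (n : ℕ+) : IsLocallyConstant fun z : ZHat => ZHatLevel.level n z := by
  refine (IsLocallyConstant.iff_eventually_eq _).2 fun z => ?_
  have hopen : IsOpen ((fun y : ZHat => z⁻¹ * y) ⁻¹' ((ZHatLevel.level n).ker : Set ZHat)) :=
    (ZHatLevel.isOpen_ker_level n).preimage (continuous_const.mul continuous_id)
  have hmem : z ∈ (fun y : ZHat => z⁻¹ * y) ⁻¹' ((ZHatLevel.level n).ker : Set ZHat) := by simp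
  filter_upwards [hopen.mem_nhds hmem] with y hy
  rw [Set.mem_preimage, SetLike.mem_coe, MonoidHom.mem_ker, map_mul, map_inv, inv_mul_eq_one] at hy
  exact hy.symm

/-! ### §3. «`Ẑ` with `χ`» `≅ T_μ(K^al)`, compatibly with `G_K ≤ G_{ℚ_p} ↔ Gal(K^al/K)` -/

namespace GalSect

variable {p : ℕ} [Fact p.Prime]

/-- **The coefficient dictionary «`Ẑ(1)` through `χ`» `=` the Tate module.**  Let `K` be a field, `L ≤ G_{ℚ_p}`,
`Φ : L → Gal(K^al/K)` and `ι : K^al ≃ ℚ̄_p` a ring isomorphism with `ι (Φ(σ) x) = σ (ι x)` (the junction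
`exists_GK_continuousMulEquiv_absoluteGaloisGroup`).  Then there is a continuous additive BIJECTION
`m : Ẑ → T_μ(K^al) = lim_n μ_n(K^al)` with `m (χ(σ) z) = Φ(σ) · m(z)` for every `σ ∈ L`, `z ∈ Ẑ` — the cyclotomic character
`χ = SettingModel.chi` on the left, the Galois action `tateModuleMu` on the right.  Construction: a generator `ξ` of
`Λ(ℚ̄_pˣ)`, `m(z)_n := ι⁻¹(ξ_n^{z mod n})`; equivariance by `σ(ζ) = ζ^{χ_n(σ)}` (`apply_eq_pow_levelChar_chi`); continuity
because `z ↦ z mod n` is locally constant. [cite: MochizukiGalSect2005, §4 p.33] -/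
theorem exists_chi_tateModule_dictionary (K : Type) [Field K] (L : Subgroup (GQp p))
    (Φ : L → Field.absoluteGaloisGroup K) (ι : AlgebraicClosure K ≃+* PadicAlgCl p)
    (hΦ : ∀ (σ : L) (x : AlgebraicClosure K), ι (Φ σ • x) = (σ : GQp p) • ι x) :
    ∃ m : ZHat → (muSystem K).limit,
      Continuous m ∧ Bijective m ∧ (∀ a b, m (a * b) = m a + m b) ∧
      ∀ (σ : L) (z : ZHat), m (SettingModel.chi p (σ : GQp p) z) = tateModuleMu K (Φ σ) (m z) := by
  classical
  haveI := SettingModel.charZero_padicAlgCl p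
  obtain ⟨ξ, e₀, hξ, -, he₀⟩ := cyclotome.exists_generator_mulEquiv_zHat_of_isSepClosed (PadicAlgCl p)
  -- units transported along `ι⁻¹`
  let u : (PadicAlgCl p)ˣ →* (AlgebraicClosure K)ˣ := Units.map (ι.symm : PadicAlgCl p ≃+* AlgebraicClosure K).toMonoidHom
  have hu : ∀ x : (PadicAlgCl p)ˣ, ((u x : (AlgebraicClosure K)ˣ) : AlgebraicClosure K) = ι.symm (x : PadicAlgCl p) :=
    fun x => rfl
  -- the level-`n` exponent of `z`
  let lev : ℕ+ → ZHat → ℕ := fun n z => (Multiplicative.toAdd (ZHatLevel.level n z)).val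
  have hlev : ∀ (n : ℕ+) (z : ZHat), (ξ : ℕ+ → (PadicAlgCl p)ˣ) n ^ lev n z = (e₀.symm z : ℕ+ → (PadicAlgCl p)ˣ) n := by
    intro n z
    have h := he₀ (e₀.symm z) n
    rwa [MulEquiv.apply_symm_apply] at h
  -- the coordinates
  let w : ∀ n : ℕ+, ZHat → (AlgebraicClosure K)ˣ := fun n z => u ((ξ : ℕ+ → (PadicAlgCl p)ˣ) n ^ lev n z)
  have hw : ∀ n z, w n z = u ((e₀.symm z : ℕ+ → (PadicAlgCl p)ˣ) n) := fun n z => by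
    change u _ = u _; rw [hlev]
  have hw_pow : ∀ (n : ℕ+) (z : ZHat), w n z ^ ((n : ℕ+) : ℕ) = 1 := fun n z => by
    rw [hw, ← map_pow, cyclotome.pow_eq_one, map_one]
  have hw_compat : ∀ (z : ZHat) {n m : ℕ+} (h : (n : ℕ) ∣ m), w m z ^ ((m : ℕ) / n) = w n z := fun z n m h => by
    rw [hw, hw, ← map_pow, cyclotome.pow_div_apply _ h]
  let m : ZHat → (muSystem K).limit := fun z =>
    ⟨fun n => muOfUnit K n (w n z) (hw_pow n z), fun n m' h => muVal_injective K n (by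
      rw [muSystem_red, muVal_muPowMap, muVal_muOfUnit, muVal_muOfUnit, hw_compat z h])⟩
  have hm : ∀ (z : ZHat) (n : ℕ+), muVal K n ((m z : ∀ n : ℕ+, MuCarrier K n) n) = w n z := fun z n => rfl
  refine ⟨m, ?_, ?_, ?_, ?_⟩
  · -- continuity: coordinate `n` factors through the locally constant `level n`
    refine continuous_induced_rng.2 (continuous_pi fun n => ?_)
    change Continuous fun z : ZHat => ((m z : ∀ n : ℕ+, MuCarrier K n) n)
    have hc := ((ZHatLevel.isLocallyConstant_level n).comp (fun c : Multiplicative (ZMod n) =>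
      if hx : u ((ξ : ℕ+ → (PadicAlgCl p)ˣ) n ^ (Multiplicative.toAdd c).val) ^ ((n : ℕ+) : ℕ) = 1 then
        muOfUnit K n _ hx else 0)).continuous
    refine hc.congr fun z => ?_
    simp only [Function.comp_apply]
    rw [dif_pos (hw_pow n z)]
  · -- bijectivity
    constructor
    · intro z z' h
      apply e₀.symm.injective
      refine Subtype.ext (funext fun n => ?_)
      have hn := congrArg (fun x : (muSystem K).limit => muVal K n ((x : ∀ n : ℕ+, MuCarrier K n) n)) h
      simp only [hm, hw] at hn
      exact Units.map_injective (f := (ι.symm : PadicAlgCl p ≃+* AlgebraicClosure K).toMonoidHom)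
        ι.symm.injective hn
    · intro x
      -- the family `(ι (x_n))_n` is an element of the cyclotome of `ℚ̄_pˣ`
      let ζf : ℕ+ → (PadicAlgCl p)ˣ := fun n =>
        Units.map (ι : AlgebraicClosure K ≃+* PadicAlgCl p).toMonoidHom (muVal K n ((x : ∀ n : ℕ+, MuCarrier K n) n))
      have hζ : ζf ∈ cyclotome (PadicAlgCl p)ˣ := by
        refine ⟨fun n => ?_, fun n m' => ?_⟩
        · change Units.map _ _ ^ _ = 1
          rw [← map_pow, muVal_pow_eq_one, map_one]
        · change Units.map _ _ ^ _ = Units.map _ _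
          rw [← map_pow]
          congr 1
          have h := congrArg (muVal K n) ((muSystem K).red_apply_coe x
            (show (muSystem K).le n (n * m') from dvd_mul_right (n : ℕ) m'))
          have hd : ((n * m' : ℕ+) : ℕ) / n = m' := by rw [PNat.mul_coe, Nat.mul_div_cancel_left _ n.pos]
          rw [muSystem_red, muVal_muPowMap, hd] at h
          exact h
      refine ⟨e₀ ⟨ζf, hζ⟩, Subtype.ext (funext fun n => muVal_injective K n ?_)⟩
      rw [hm, hw, MulEquiv.symm_apply_apply]
      change Units.map _ (Units.map _ _) = _
      ext
      simp
  · -- additivity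
    intro a b
    refine Subtype.ext (funext fun n => muVal_injective K n ?_)
    change muVal K n ((m (a * b) : ∀ n : ℕ+, MuCarrier K n) n) =
      muVal K n ((m a : ∀ n : ℕ+, MuCarrier K n) n + (m b : ∀ n : ℕ+, MuCarrier K n) n)
    rw [muVal_add, hm, hm, hm, hw, hw, hw, map_mul e₀.symm, Subgroup.coe_mul, Pi.mul_apply, map_mul]
  · -- equivariance: `σ(ξ_n^a) = ξ_n^(χ_n(σ) a)`
    intro σ z
    refine Subtype.ext (funext fun n => muVal_injective K n ?_)
    haveI : NeZero ((n : ℕ+) : ℕ) := ⟨n.ne_zero⟩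
    rw [hm]
    change w n (SettingModel.chi p (σ : GQp p) z) = muVal K n (mu K n (Φ σ) ((m z : ∀ n : ℕ+, MuCarrier K n) n))
    rw [muVal_apply, hm]
    apply Units.ext
    change ((u _ : (AlgebraicClosure K)ˣ) : AlgebraicClosure K) = ((Φ σ • w n z : (AlgebraicClosure K)ˣ) : AlgebraicClosure K)
    have hsmul : ((Φ σ • w n z : (AlgebraicClosure K)ˣ) : AlgebraicClosure K) =
        Φ σ • ((w n z : (AlgebraicClosure K)ˣ) : AlgebraicClosure K) := rfl
    rw [hsmul, hu]
    change _ = Φ σ • ((u _ : (AlgebraicClosure K)ˣ) : AlgebraicClosure K)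
    rw [hu]
    -- move `ι` across using `hΦ`
    apply ι.injective
    rw [hΦ, RingEquiv.apply_symm_apply, RingEquiv.apply_symm_apply]
    -- now in `ℚ̄_p`: `ξ_n ^ (χ_n(σ) a) = σ (ξ_n ^ a)`
    rw [Units.val_pow_eq_pow_val, Units.val_pow_eq_pow_val]
    have hμN : ((((ξ : ℕ+ → (PadicAlgCl p)ˣ) n : (PadicAlgCl p)ˣ) : PadicAlgCl p) ^ lev n z) ^ ((n : ℕ+) : ℕ) = 1 := by
      rw [← pow_mul, mul_comm, pow_mul, ← Units.val_pow_eq_pow_val, cyclotome.pow_eq_one, Units.val_one, one_pow]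
    have hσ : (σ : GQp p) • (((ξ : ℕ+ → (PadicAlgCl p)ˣ) n : (PadicAlgCl p)ˣ) : PadicAlgCl p) ^ lev n z =
        ((((ξ : ℕ+ → (PadicAlgCl p)ˣ) n : (PadicAlgCl p)ˣ) : PadicAlgCl p) ^ lev n z) ^
          (ZHatLevel.levelChar n (SettingModel.chi p (σ : GQp p))).val := by
      rw [AlgEquiv.smul_def]
      exact SettingModel.apply_eq_pow_levelChar_chi p (σ : GQp p) n hμN
    have hξn : (((ξ : ℕ+ → (PadicAlgCl p)ˣ) n : (PadicAlgCl p)ˣ) : PadicAlgCl p) ^ ((n : ℕ+) : ℕ) = 1 := by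
      rw [← Units.val_pow_eq_pow_val, cyclotome.pow_eq_one, Units.val_one]
    rw [hσ, ← pow_mul, pow_eq_pow_mod _ hξn, pow_eq_pow_mod (lev n z * _) hξn]
    congr 1
    change (Multiplicative.toAdd (ZHatLevel.level n (SettingModel.chi p (σ : GQp p) z))).val % (n : ℕ) = _
    rw [ZHatLevel.toAdd_level_aut, ZMod.val_mul, Nat.mod_mod, mul_comm]

end GalSect

end Literature.AnabelianGeometry.EtaleTheta

end
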